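import Literature.MathematicalPhysics.QuantumFieldTheory.Balaban1983to89.B9Thm39FacesAtLettersRCPar

/-!
# [Balaban1985BackgroundPropagators] Theorem 3.9 — ROWS 15 ∧ 16 (`Thm39Printed ∧ RWKernelSumYields`) AT THE LETTERS WITH THE AVERAGING TRANSPORTER EXPLICIT,
# ALONG A SUB-FAMILY `f : J → MemberY …` — the J-twins of ✓`B9Thm39FacesAtLettersRCPar.t39_hksum_of_pins_opsYOfLetters_FRC_par` and
# ✓`….t39_hksum_oneCube_opsYOfLetters_FRC_par` (dag-n06-d g25; consumer «KCXS» `…N06AtOpsYSectEStKnitPairKCXS` l.279 → its twin)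

Cell `pub-ymgap` (HUMAN RULING D-0062), node N06; IR-N06-SECTION-2 road **R1** («J-twin of the producer cone», ★★★ director-ym №524 (3): STAGED, sibling files only),
dag-n06-d's `R1-JTWIN-SPEC.md` rule (R)′.  Seat `pub-ymgap-dag-n06-d` g30 (own producer).  THIS is the second entry point of rows 15∕16 into the cone (the first is
✓`…N06Proj349AtPinsPhysRCParJ`): under R1 the one-cube display `h348` is a theorem on `J := SCMemberY` only (dag-n06-j ✓`B9Thm32KnitRows1516ThresholdsY`), so print's
Theorem 3.9 and the kernel-sum row come out for the sub-family `j ↦ geo9Y (f j)`.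

WHAT.
* `t39_hksum_of_pins_opsYOfLetters_FRC_par_J` — the parent's generic-letters reader with `{J : Type} (f : J → MemberY …)` FIRST: the Thm-3.9 block operators `𝔬39`, the
  walk reading `rd39` (over `J`-indexed index types `ιJ κJ`, so that unification through `f j` stays first-order) and every row about them (`hst hloc h39 hblk hL hEK39`) are INDEXED BY `J` (data built per member by the caller), the letter families ∕ pins
  `𝔏 𝔈 bI parA hC hβI` stay member-wide (read at `f j`); conclusion `B9.Thm39Printed (θ.d₆+1) c (fun j => geo9Y (f j)) (fun j => bg9YR … (f j)) (fun j => … (f j) …) ∧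
  B9.RWKernelSumYields …` along `f`.  PROOF (one genuine point): the pinned datum `EK39` carries the [4] (2.61) constant `rowConst261 geo9Y (α'r)` of the FULL member family (a `Classical.choose`),
  while the index-generic pin-leaf at `I := J` would choose `rowConst261 (geo9Y ∘ f)`; so this twin assembles the CONSTANT-EXPLICIT leaves instead —
  ✓`thm39Printed_of_local348BlkVia` (row 15, constants `c c'` as parameters) and ✓`rwKernelSumYields_of_conv348BlkVia` (row 16) — feeding the full family's
  (2.61) facts ✓`ineq261With_pair_rowConst261_of_rowSum261 … rowSum261_geo9Y` restricted along `f`; the carrier-kernel reading is ✓`reading_le_of_letters_F_par` at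
  `f j` (the parent's `kerReadsLeVia_opsYOfLettersR_F_par` unfolded one step).
* ★★★ `t39_hksum_oneCube_opsYOfLetters_FRC_par_J` — the parent's one-cube face along `f`: TAINTED ROW `h348` (the (3.48) one-cube block-convergence display, `∀ x ↦ ∀ j`, read at
  `f j`); `hC hβI hEK39` member-wide; proof = the parent's term with the one-cube data at `f j`.
HONEST FRAMING.  Re-indexing only; Theorem 3.9's content is in the index-generic leaf; the (3.48) display is a HYPOTHESIS; nothing of [B9] ∕ [4] asserted beyond the
parents; COUNT-NEUTRAL (`--supports stmt-QuantumFields-27239`); N06 NOT discharged; under R1 the inner-corner question stays DISPLAYED at the K1 face ∕ NODE O join by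
(α5); nothing continuum ∕ OS ∕ mass gap ∕ Clay.  0 `def`, 0 `sorry`.  NEW file; the parent untouched.  The member-wide parents are the instances `J := MemberY …`, `f := id`.
[cite: Balaban1985BackgroundPropagators, Thm 3.9 (3.98)–(3.99) p.413, Thm 3.2 (3.48) p.398, (3.95)–(3.96) p.411, (3.19) p.393, (3.35) p.396; Balaban1985Averaging, Prop. 2 p.26;
Balaban1984PropagatorsII, (2.45) p.231, (2.51) p.232, Lemma 2.1 (2.61) p.234, p.248]
-/

noncomputable section

namespace Literature.MathematicalPhysics.QuantumFieldTheory.Balaban1983to89.B9Thm39FacesAtLettersRCParJ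

open Literature.MathematicalPhysics.QuantumFieldTheory.Balaban1983to89
open Finset B6RandomWalk B9Thm39Whole B9Thm39WholeBlk B9Thm39WholeBlkVia B9Thm39WholeBlkViaDatum B9Thm39ReadingCoords B9Thm39ReadingAtLetters
  B9Thm39ReadingFaithful B9Thm39Thm311AtLettersR B9Thm39OneCubeReadingAtLettersY B9Thm39PureGaugeClassAtLettersR Node00
open B6KLevelCensusIndexV1 B6Geom246MultiLevelBox B6Geom246MultiLevelTorus B6Ineq2142KLevelV1 B6GlobalChartV1 B9PinMembersKLevelV1
  B9PinCarriersKLevelV1 B9PinGeometryKLevelV1 B7Prop2SpecialUnitary B9Ineq349SiteFromConv348 B9BackgroundsKLevelV1R B9BackgroundsKLevelV1P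
  B9GeoLemma21KLevelV1
open B9Thm34Inv


section LettersRCPar

open scoped Matrix.Norms.L2Operator

variable {N : ℕ} (θ : Stage3Params) (Mstar : ℕ) (𝔏 : LettersY N θ Mstar) (𝔈 : ExpsY N θ Mstar)
variable [∀ x : MemberY θ.d₆ θ.ℓ₆ θ.hd' θ.hL' θ.b₀ θ.b₁ Mstar, Fintype (geo9Y x).Site]
  [∀ x : MemberY θ.d₆ θ.ℓ₆ θ.hd' θ.hL' θ.b₀ θ.b₁ Mstar, DecidableEq (geo9Y x).Site]
variable {ι κ : MemberY θ.d₆ θ.ℓ₆ θ.hd' θ.hL' θ.b₀ θ.b₁ Mstar → Type} [∀ x, Fintype (ι x)]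
variable (R₁ R₂ : RegFamY θ.d₆ θ.ℓ₆ θ.hd' θ.hL' θ.b₀ θ.b₁ Mstar (Matrix (Fin N) (Fin N) ℂ))
variable (bI : ∀ x : MemberY θ.d₆ θ.ℓ₆ θ.hd' θ.hL' θ.b₀ θ.b₁ Mstar, FBondY x.toKIdx → IBondY x.toKIdx)
  (parA : ∀ x : MemberY θ.d₆ θ.ℓ₆ θ.hd' θ.hL' θ.b₀ θ.b₁ Mstar, SiteParY (Matrix (Fin N) (Fin N) ℂ) x.toKIdx)


/-- ★★ rows 15 ∧ 16 at generic `J`-indexed Thm-3.9 block letters on the faithful block map, generic `(R₁, R₂, c)`, averaging transporter explicit — the parent's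
`t39_hksum_of_pins_opsYOfLetters_FRC_par` along `f : J → MemberY …`.
[cite: Balaban1985BackgroundPropagators, Thm 3.9 (3.98)–(3.99) p.413 + Thm 3.2 (3.48) p.398 + (3.25) p.395 + (3.19) p.393 + (3.35) p.396; Balaban1984PropagatorsII, Lemma 2.1 (2.61) p.234 + (2.45) p.231 + (2.51) p.232] -/
theorem t39_hksum_of_pins_opsYOfLetters_FRC_par_J {J : Type} (f : J → MemberY θ.d₆ θ.ℓ₆ θ.hd' θ.hL' θ.b₀ θ.b₁ Mstar) {ιJ κJ : J → Type} [∀ j, Fintype (ιJ j)]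
    (𝔬39 : ∀ j : J,
      Ops39Blk (geo9Y (f j)) (bg9YR (Matrix (Fin N) (Fin N) ℂ) (specialUnitaryUnits (Fin N)) R₁ R₂ (f j)) (X39 (Matrix (Fin N) (Fin N) ℂ) (f j).toKIdx)
        (ιJ j) (κJ j))
    (rd39 : ∀ j : J,
      WalkReading39 (bg9YR (Matrix (Fin N) (Fin N) ℂ) (specialUnitaryUnits (Fin N)) R₁ R₂ (f j)) (ιJ j) (κJ j))
    (c α α' r δ₀ θ₀ B₀ N₀ a₁ M₁ : ℝ) (hc : 0 < c)
    (hα : 0 < α) (hα1 : α < 1) (hα'0 : 0 < α') (hα'1 : α' < 1) (hr : 0 < r) (hrδ : r ≤ δ₀) (hθ₀ : 0 ≤ θ₀) (hB₀ : 0 < B₀)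
    (hN₀ : 0 ≤ N₀) (ha₁ : 0 < a₁) (hM₁ : 0 < M₁)
    (hst : ∀ j, StaticOK39Blk (𝔬39 j) N₀) (hloc : ∀ j, Locality39Blk (𝔬39 j) (rd39 j))
    (h39 : ∀ j : J, M₁ ≤ (geo9Y (f j)).M → ∀ α₀ : ℝ, 0 < α₀ → c * (geo9Y (f j)).M * α₀ ≤ a₁ →
      ∀ U : (bg9YR (Matrix (Fin N) (Fin N) ℂ) (specialUnitaryUnits (Fin N)) R₁ R₂ (f j)).Cfg,
        (bg9YR (Matrix (Fin N) (Fin N) ℂ) (specialUnitaryUnits (Fin N)) R₁ R₂ (f j)).Reg335 c α₀ U →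
        Local348Blk (𝔬39 j) B₀ δ₀ U ∧ Identities395Blk (𝔬39 j) U ∧ Small285Blk (𝔬39 j) θ₀ r U ∧ Factors389Blk (𝔬39 j) θ₀ δ₀ U)
    (hC : ∀ x : MemberY θ.d₆ θ.ℓ₆ θ.hd' θ.hL' θ.b₀ θ.b₁ Mstar, (𝔏 x).C = CY x.toKIdx (parA x) (𝔏 x).Gp)
    (hβI : ∀ (x : MemberY θ.d₆ θ.ℓ₆ θ.hd' θ.hL' θ.b₀ θ.b₁ Mstar) (f : FBondY x.toKIdx) (c : IBondY x.toKIdx),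
      blkV1 x.hN x.D f = β x.hN x.D x.hk c → β x.hN x.D x.hk (bI x f) = blkV1 x.hN x.D f)
    (hblk : ∀ j, (𝔬39 j).blk = blk39F (Matrix (Fin N) (Fin N) ℂ) (f j).toKIdx (bI (f j)))
    (hL : ∀ j, (𝔬39 j).L = L39 (f j).toKIdx (parA (f j)) (𝔏 (f j)).Gp)
    (hEK39 : ∀ j : J, rwKernelExpansionR R₁ R₂ ((opsYOfLetters N θ Mstar 𝔏 𝔈) (f j)).EK39 =
      EK39OfOpsBlkVia (𝔬39 j) (rd39 j) (θ.d₆ + 1)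
        (2 * (N₀ * B₀) * B9RowSum261DefiniteFaces.rowConst261 (geo9Y (d := θ.d₆) (ℓ := θ.ℓ₆) (hd := θ.hd') (hL := θ.hL')
          (b₀ := θ.b₀) (b₁ := θ.b₁) (Mstar := Mstar)) (α' * r)) ((1 - α') * r) (repSite39F (f j).toKIdx (bI (f j)))) :
    B9.Thm39Printed (θ.d₆ + 1) c (fun j : J => geo9Y (f j)) (fun j : J => bg9YR (Matrix (Fin N) (Fin N) ℂ) (specialUnitaryUnits (Fin N)) R₁ R₂ (f j))
        (fun j => rwKernelExpansionR R₁ R₂ ((opsYOfLetters N θ Mstar 𝔏 𝔈) (f j)).EK39) ∧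
      B9.RWKernelSumYields (θ.d₆ + 1) (fun j : J => geo9Y (f j)) (fun j : J => bg9YR (Matrix (Fin N) (Fin N) ℂ) (specialUnitaryUnits (Fin N)) R₁ R₂ (f j))
        (fun j => rwKernelExpansionR R₁ R₂ ((opsYOfLetters N θ Mstar 𝔏 𝔈) (f j)).EK39)
        (fun j => siteKernelR R₁ R₂ ((opsYOfLetters N θ Mstar 𝔏 𝔈) (f j)).Cinv) := by
  have hδ₀ : 0 < δ₀ := lt_of_lt_of_le hr hrδ
  have hδ₁ : 0 < (1 - α') * r := mul_pos (by linarith) hr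
  have hcR : 0 ≤ cR39 (basis39 (Matrix (Fin N) (Fin N) ℂ)) * Fintype.card (κ39 (Matrix (Fin N) (Fin N) ℂ)) :=
    mul_nonneg (cR39_nonneg _) (Nat.cast_nonneg _)
  have hB₁ : 0 ≤ 2 * (N₀ * B₀) * B9RowSum261DefiniteFaces.rowConst261 (geo9Y (d := θ.d₆) (ℓ := θ.ℓ₆) (hd := θ.hd') (hL := θ.hL') (b₀ := θ.b₀) (b₁ := θ.b₁) (Mstar := Mstar)) (α' * r) :=
    mul_nonneg (mul_nonneg zero_le_two (mul_nonneg hN₀ hB₀.le)) (B9RowSum261DefiniteFaces.rowConst261_nonneg _ _)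
  -- [4] (2.61) at both rates for the FULL member family (its chosen constants are the pinned ones), restricted along `f`
  obtain ⟨ML, h261⟩ := B9RowSum261DefiniteFaces.ineq261With_pair_rowConst261_of_rowSum261 (geo := (geo9Y (d := θ.d₆) (ℓ := θ.ℓ₆) (hd := θ.hd') (hL := θ.hL') (b₀ := θ.b₀) (b₁ := θ.b₁) (Mstar := Mstar)))
    (fun _ => (0 : ℝ)) (fun _ => True) (mul_pos hα hδ₀) (mul_pos hα'0 hr)
    (rowSum261_geo9Y (d := θ.d₆) (ℓ := θ.ℓ₆) (hd := θ.hd') (hL := θ.hL') (b₀ := θ.b₀) (b₁ := θ.b₁) (Mstar := Mstar))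
  have hE : (fun j : J => rwKernelExpansionR R₁ R₂ ((opsYOfLetters N θ Mstar 𝔏 𝔈) (f j)).EK39) = fun j => EK39OfOpsBlkVia (𝔬39 j) (rd39 j) (θ.d₆ + 1)
      (2 * (N₀ * B₀) * B9RowSum261DefiniteFaces.rowConst261 (geo9Y (d := θ.d₆) (ℓ := θ.ℓ₆) (hd := θ.hd') (hL := θ.hL') (b₀ := θ.b₀) (b₁ := θ.b₁) (Mstar := Mstar)) (α' * r)) ((1 - α') * r) (repSite39F (f j).toKIdx (bI (f j))) := funext hEK39
  have hπlen : ∀ (j : J) (y : (geo9Y (f j)).Site), (geo9Y (f j)).len (repSite39F (f j).toKIdx (bI (f j)) y) = (geo9Y (f j)).len y :=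
    fun j y => len_repSite39F (hβI (f j)) y
  have hπl : ∀ (j : J) (y z : (geo9Y (f j)).Site), (geo9Y (f j)).dist (repSite39F (f j).toKIdx (bI (f j)) y) z = (geo9Y (f j)).dist y z :=
    fun j y z => dist_repSite39F_left (hβI (f j)) y z
  have hπr : ∀ (j : J) (z y : (geo9Y (f j)).Site), (geo9Y (f j)).dist z (repSite39F (f j).toKIdx (bI (f j)) y) = (geo9Y (f j)).dist z y :=
    fun j z y => dist_repSite39F_right (hβI (f j)) z y
  rw [hE]
  refine ⟨thm39Printed_of_local348BlkVia 𝔬39 rd39 (fun j => repSite39F (f j).toKIdx (bI (f j))) _ _ (θ.d₆ + 1) α α' r δ₀ θ₀ B₀ N₀ a₁ M₁ ML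
      (B9RowSum261DefiniteFaces.rowConst261_nonneg _ _) (B9RowSum261DefiniteFaces.rowConst261_nonneg _ _) hc hα.le hα1 hα'1.le hr.le hrδ hδ₀ hθ₀ hB₀
      hN₀ ha₁ hM₁ hst hloc hπlen hπl hπr (fun j hM => h261 (f j) hM) h39, ?_⟩
  exact rwKernelSumYields_of_conv348BlkVia 𝔬39 (fun j => siteKernelR R₁ R₂ ((opsYOfLetters N θ Mstar 𝔏 𝔈) (f j)).Cinv) (θ.d₆ + 1)
    (fun j => repSite39F (f j).toKIdx (bI (f j))) hB₁ hδ₁ hcR (fun j y => (hst j).lenpos y) hπlen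
    (fun j y y' => by rw [hπl, hπr]) (fun _ _ h => h)
    (fun j => fun U T hTL hLT y y' =>
      B9Thm39FacesAtLettersRCPar.reading_le_of_letters_F_par (f j) (𝔏 (f j)) (𝔈 (f j)) (parA (f j)) (hC (f j))
        ⟨(𝔬39 j).blk, (𝔬39 j).S, (𝔬39 j).h, (𝔬39 j).chi, (𝔬39 j).L, (𝔬39 j).Lloc, (𝔬39 j).Cl, (𝔬39 j).Sw, (𝔬39 j).Rw⟩
        (hblk j) (hL j) U T hTL hLT y y')


omit [∀ x, Fintype (ι x)] in
/-- ★★★ **ROWS 15 ∧ 16 AT GENERIC `(R₁, R₂, c)` FROM ONE DISPLAY ON THE FAITHFUL ONE-CUBE LETTERS, ALONG A SUB-FAMILY `f`** — the parent's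
`t39_hksum_oneCube_opsYOfLetters_FRC_par` with the (3.48) one-cube display `h348` re-keyed `∀ j : J` (read at `f j`); everything else member-wide.
[cite: Balaban1985BackgroundPropagators, Thm 3.9 (3.98)–(3.99) p.413 + Thm 3.2 (3.48) p.398 + (3.95)–(3.96) p.411 + (3.19) p.393 + (3.35) p.396; Balaban1985Averaging, Prop. 2 p.26; Balaban1984PropagatorsII, (2.45) p.231 + (2.51) p.232 + Lemma 2.1 (2.61) p.234 + p.248] -/
theorem t39_hksum_oneCube_opsYOfLetters_FRC_par_J {J : Type} (f : J → MemberY θ.d₆ θ.ℓ₆ θ.hd' θ.hL' θ.b₀ θ.b₁ Mstar) (c α' r B₀ δ₀ a₁ M₁ : ℝ) (hc : 0 < c)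
    (hα'0 : 0 < α') (hα'1 : α' < 1) (hr : 0 < r) (hrδ : r ≤ δ₀) (hB₀ : 0 < B₀) (ha₁ : 0 < a₁) (hM₁ : 0 < M₁)
    (h348 : ∀ j : J, M₁ ≤ (geo9Y (f j)).M → ∀ α₀ : ℝ, 0 < α₀ → c * (geo9Y (f j)).M * α₀ ≤ a₁ →
      ∀ U : (bg9YR (Matrix (Fin N) (Fin N) ℂ) (specialUnitaryUnits (Fin N)) R₁ R₂ (f j)).Cfg,
        (bg9YR (Matrix (Fin N) (Fin N) ℂ) (specialUnitaryUnits (Fin N)) R₁ R₂ (f j)).Reg335 c α₀ U →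
          Conv348Blk (oneCubeOps39 (geo9Y (f j)) (bg9YR (Matrix (Fin N) (Fin N) ℂ) (specialUnitaryUnits (Fin N)) R₁ R₂ (f j))
            (blk39F (Matrix (Fin N) (Fin N) ℂ) (f j).toKIdx (bI (f j))) (L39 (f j).toKIdx (parA (f j)) (𝔏 (f j)).Gp)) B₀ δ₀ U)
    (hC : ∀ x : MemberY θ.d₆ θ.ℓ₆ θ.hd' θ.hL' θ.b₀ θ.b₁ Mstar, (𝔏 x).C = CY x.toKIdx (parA x) (𝔏 x).Gp)
    (hβI : ∀ (x : MemberY θ.d₆ θ.ℓ₆ θ.hd' θ.hL' θ.b₀ θ.b₁ Mstar) (f : FBondY x.toKIdx) (c : IBondY x.toKIdx),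
      blkV1 x.hN x.D f = β x.hN x.D x.hk c → β x.hN x.D x.hk (bI x f) = blkV1 x.hN x.D f)
    (hEK39 : ∀ x : MemberY θ.d₆ θ.ℓ₆ θ.hd' θ.hL' θ.b₀ θ.b₁ Mstar,
      rwKernelExpansionR R₁ R₂ ((opsYOfLetters N θ Mstar 𝔏 𝔈) x).EK39 =
      EK39OfOpsBlkVia (oneCubeOps39 (geo9Y x) (bg9YR (Matrix (Fin N) (Fin N) ℂ) (specialUnitaryUnits (Fin N)) R₁ R₂ x)
          (blk39F (Matrix (Fin N) (Fin N) ℂ) x.toKIdx (bI x)) (L39 x.toKIdx (parA x) (𝔏 x).Gp)) (oneCubeReading39 _) (θ.d₆ + 1)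
        (2 * (1 * B₀) * B9RowSum261DefiniteFaces.rowConst261 (geo9Y (d := θ.d₆) (ℓ := θ.ℓ₆) (hd := θ.hd') (hL := θ.hL')
          (b₀ := θ.b₀) (b₁ := θ.b₁) (Mstar := Mstar)) (α' * r)) ((1 - α') * r) (repSite39F x.toKIdx (bI x))) :
    B9.Thm39Printed (θ.d₆ + 1) c (fun j : J => geo9Y (f j)) (fun j : J => bg9YR (Matrix (Fin N) (Fin N) ℂ) (specialUnitaryUnits (Fin N)) R₁ R₂ (f j))
        (fun j => rwKernelExpansionR R₁ R₂ ((opsYOfLetters N θ Mstar 𝔏 𝔈) (f j)).EK39) ∧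
      B9.RWKernelSumYields (θ.d₆ + 1) (fun j : J => geo9Y (f j)) (fun j : J => bg9YR (Matrix (Fin N) (Fin N) ℂ) (specialUnitaryUnits (Fin N)) R₁ R₂ (f j))
        (fun j => rwKernelExpansionR R₁ R₂ ((opsYOfLetters N θ Mstar 𝔏 𝔈) (f j)).EK39)
        (fun j => siteKernelR R₁ R₂ ((opsYOfLetters N θ Mstar 𝔏 𝔈) (f j)).Cinv) :=
  t39_hksum_of_pins_opsYOfLetters_FRC_par_J θ Mstar 𝔏 𝔈 R₁ R₂ bI parA f
    (fun j => oneCubeOps39 (geo9Y (f j)) (bg9YR (Matrix (Fin N) (Fin N) ℂ) (specialUnitaryUnits (Fin N)) R₁ R₂ (f j))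
      (blk39F (Matrix (Fin N) (Fin N) ℂ) (f j).toKIdx (bI (f j))) (L39 (f j).toKIdx (parA (f j)) (𝔏 (f j)).Gp)) (fun _ => oneCubeReading39 _)
    c (1 / 2) α' r δ₀ 0 B₀ 1 a₁ M₁ hc one_half_pos one_half_lt_one hα'0 hα'1 hr hrδ le_rfl hB₀ zero_le_one ha₁ hM₁
    (fun j => staticOK39Blk_oneCube _ _ (geo9Y_dist_triangle (f j)) (geo9Y_dist_self (f j)) (geo9K_dist_nonneg' (f j).toKIdx) (geo9Y_len_pos (f j)))
    (fun _ => locality39Blk_oneCube _ _)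
    (fun j hM α₀ hα ha U hU => schemas39_oneCube_of_conv348 _ _ r le_rfl (geo9Y_M_nonneg θ Mstar (f j)) (h348 j hM α₀ hα ha U hU))
    hC hβI (fun _ => rfl) (fun _ => rfl) (fun j => hEK39 (f j))

end LettersRCPar

end Literature.MathematicalPhysics.QuantumFieldTheory.Balaban1983to89.B9Thm39FacesAtLettersRCParJ

end
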